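import Mathlib
import Summits.NavierStokesRegularity.NavierStokesRegularity.Theorems.EulerZoomLiouvillePowerGaugeEulerLiouvilleWeakSupportDensityLaw
import Summits.NavierStokesRegularity.NavierStokesRegularity.Theorems.EulerZoomLiouvillePowerGaugeEulerLiouvilleWeakCasimirMass
import HarnessLib

/-!
# Crux `EulerZoomLiouville.PowerGaugeEulerLiouville` (stmt-NavierStokesRegularity-19832), weak stratum, line `weak_axisym` (ns-idea-11 g9):
# THE CASIMIR RACE — `stub_casimirRace` (X2) filled

Route №10 `EulerZoomLiouville` (NavierStokesRegularity), crux E = stmt-NavierStokesRegularity-19832; width seat ns-ezl-w1 g9 under the LEAD ns-typeII-p2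
(tools `…WeakCasimirRaceTools` by ns-ezl-w2 g6; the race inequality `…WeakCasimirMass.casimir_mass_le`).
A weak exactly self-similar class member (any `ρ ∈ (0,½]`, `γ = 1/(2+ρ)`) whose a.e. vorticity is `Ω = η·k` for a scalar `η ∈ L²_loc` (the Casimir
`ω_θ/ϱ` of the Ukhovskii–Yudovich axisymmetric swirl-free stratum, `k = k×y`) of mild growth `∫_{B_R} η² ≤ C R^m`, `m < 1`, which is a RENORMALISED solution
of the damped Casimir law `div(Wβ(η)) = 3γβ(η) − (1+γ)ηβ′(η)`, is trivial:

* `casimirRace` — **`Sig.stub_casimirRace` of `Lines/weak_axisym.lean` δ-unfolded** (fill: `intro ρ hρ hρh u p H c V P G hcl hss hG hazi hη2 hgr hren;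
  exact WeakAxisym.casimirRace hρ hρh hcl hss hG hazi hη2 hgr hren`): `casimir_mass_le` + the certified `A`-gauge growth `∫_{B_L}‖V‖² ≤ C_A L^{1−2ρ}` +
  `∫_{B_{2R}}η² ≤ 2CR` (only `m ≤ 1` is used) give `(1−2γ)∫_{B_{R₀}}β₁(η) ≤ K·R^{−ρ} → 0`, so `η = 0` a.e. ⇒ `Ω = 0` a.e. ⇒ `G` a.e. symmetric, trace-free,
  growth `1 − 2ρ < 3` ⇒ `V = 0` a.e. (`ae_eq_zero_of_symm_traceFree_of_growth`) ⇒ `u = 0` a.e. on the slab (closing of `WeakEulerian.supportDensityLaw`).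
[folklore; Ukhovskii–Yudovich 1968 / Majda–Bertozzi §4.3; DiPernaLions1989 §II; tree ROUND-37 `NeedleRace.selfSimilar_ae_eq_zero_of_axisymNoSwirlC2`]

WHAT THIS IS NOT: not NS, not E, not X0/X1a/X1b (weak vorticity equation, axisymmetric reduction, DiPerna–Lions renormalisation of the Casimir) — a member
theorem on the UY-axisymmetric weak stratum MODULO those bricks; 19832 is OPEN.
-/

noncomputable section

-- flat `Theorems/<Route><Decl>…` files of one crux share the namespace of the crux (tree convention)
set_option linter.dupNamespace false

open MeasureTheory Set Filter Topology Metric Function TopologicalSpace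
open scoped ENNReal NNReal RealInnerProductSpace ContDiff

namespace Summit.NavierStokesRegularity.NavierStokesRegularity.Theorems.PowerGaugeEulerLiouville.WeakAxisym

open Literature.Analysis Literature.Analysis.FunctionSpaces Literature.Analysis.FluidPDE
open Summit.NavierStokesRegularity.NavierStokesRegularity.Theorems.PowerGaugeEulerLiouville

/-! ### The member-level theorem (the line's stub X2, δ-unfolded) -/

section Member

/-- **`stub_casimirRace` (X2) of `Lines/weak_axisym.lean`**, with `InClass`, `IsExactlySelfSimilar`, `IsProfileGradient`, `IsAzimuthalVorticity`, `etaOf`, `kcross`,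
`HasRenormalisedEta`, `transportW` δ-unfolded and the Casimir GENERALISED to an arbitrary scalar `η` with `Ω = η·k` a.e. for an arbitrary field `k` (the line fills it by
`intro ρ hρ hρh u p H c V P G hcl hss hG hazi hη2 hgr hren; exact WeakAxisym.casimirRace hρ hρh hcl hss hG hazi hη2 hgr hren`, `η := etaOf G`, `k := kcross`):
a weak exactly self-similar class member (any `ρ ∈ (0,½]`) whose a.e. vorticity factors as `curlCLM ∘ G = η·k` with `η ∈ L²_loc` of growth `∫_{B_R} η² ≤ C R^m`
(`m < 1`), `η` a renormalised solution of the damped Casimir law `div(Wβ(η)) = 3γβ(η) − (1+γ)ηβ′(η)`, is trivial.  THE RACE: `casimir_mass_le` + the `A`-gauge growth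
`∫_{B_L}‖V‖² ≤ C_A L^{1−2ρ}` give `(1−2γ)∫_{B_{R₀}}β(η) ≤ K·R^{−ρ} → 0`, so `η = 0` a.e., `Ω = 0` a.e., and the weak Liouville closes.
[folklore; Ukhovskii–Yudovich 1968 / Majda–Bertozzi §4.3; DiPernaLions1989 §II; tree ROUND-37 `NeedleRace.selfSimilar_ae_eq_zero_of_axisymNoSwirlC2`] -/
theorem casimirRace {ρ : ℝ} (hρ : 0 < ρ) (hρh : ρ ≤ 1 / 2)
    {u : ℝ → EuclideanSpace ℝ (Fin 3) → EuclideanSpace ℝ (Fin 3)} {p : ℝ → EuclideanSpace ℝ (Fin 3) → ℝ}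
    {H : ℝ → EuclideanSpace ℝ (Fin 3) → EuclideanSpace ℝ (Fin 3) →L[ℝ] EuclideanSpace ℝ (Fin 3)} {c : ℝ≥0}
    {V : EuclideanSpace ℝ (Fin 3) → EuclideanSpace ℝ (Fin 3)} {P : EuclideanSpace ℝ (Fin 3) → ℝ}
    {G : EuclideanSpace ℝ (Fin 3) → EuclideanSpace ℝ (Fin 3) →L[ℝ] EuclideanSpace ℝ (Fin 3)}
    {η : EuclideanSpace ℝ (Fin 3) → ℝ} {k : EuclideanSpace ℝ (Fin 3) → EuclideanSpace ℝ (Fin 3)}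
    (hcls : IsSuitableWeakSolutionOn (slab (EuclideanSpace ℝ (Fin 3)) (Set.Iio 0) isOpen_Iio) 0 0 u p ∧
      HasWeakSpatialGradientOn (slab (EuclideanSpace ℝ (Fin 3)) (Set.Iio 0) isOpen_Iio) u H ∧
      (∀ a : ℝ, 0 < a →
        ENNReal.ofReal (a ^ (2 * ρ)) * cknA a (0 : ℝ × EuclideanSpace ℝ (Fin 3)) u +
            ENNReal.ofReal (a ^ ρ) * cknE a (0 : ℝ × EuclideanSpace ℝ (Fin 3)) H +
          ENNReal.ofReal (a ^ (2 * ρ)) * cknD a (0 : ℝ × EuclideanSpace ℝ (Fin 3)) p ≤ (c : ℝ≥0∞)))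
    (hss : (∀ τ : ℝ, τ < 0 → u τ = selfSimilarCollapse (1 / (2 + ρ)) 0 V τ) ∧
      (∀ τ : ℝ, τ < 0 → p τ = selfSimilarCollapsePressure (1 / (2 + ρ)) 0 P τ))
    (hPG : HasWeakFDerivOn (⊤ : Opens (EuclideanSpace ℝ (Fin 3))) volume V G ∧
      (∀ r : ℝ, MemLp G 2 (volume.restrict (ball (0 : EuclideanSpace ℝ (Fin 3)) r))) ∧
      (∀ r : ℝ, MemLp V 6 (volume.restrict (ball (0 : EuclideanSpace ℝ (Fin 3)) r))) ∧
      HasWeakFDerivOn (⊤ : Opens (EuclideanSpace ℝ (Fin 3))) volume (selfSimilarTransport (1 / (2 + ρ)) 0 V)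
        (fun x => (1 / (2 + ρ)) • ContinuousLinearMap.id ℝ (EuclideanSpace ℝ (Fin 3)) + G x))
    (hazi : ∀ᵐ y ∂(volume : Measure (EuclideanSpace ℝ (Fin 3))), curlCLM (G y) = η y • k y)
    (hη2 : ∀ r : ℝ, MemLp η 2 (volume.restrict (ball (0 : EuclideanSpace ℝ (Fin 3)) r)))
    (hgr : ∃ C m : ℝ, m < 1 ∧ ∀ R : ℝ, 1 ≤ R → ∫ y in ball (0 : EuclideanSpace ℝ (Fin 3)) R, η y ^ 2 ≤ C * R ^ m)
    (hren : ∀ β : ℝ → ℝ, ContDiff ℝ 1 β → (∃ C : ℝ, ∀ s : ℝ, ‖deriv β s‖ ≤ C) →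
      ∀ ψ : EuclideanSpace ℝ (Fin 3) → ℝ, IsTestFunctionOn (⊤ : Opens (EuclideanSpace ℝ (Fin 3))) ψ →
        ∫ y, β (η y) * (3 * (1 / (2 + ρ)) * ψ y + fderiv ℝ ψ y (selfSimilarTransport (1 / (2 + ρ)) 0 V y)) =
          ∫ y, ψ y * ((1 + 1 / (2 + ρ)) * η y * deriv β (η y))) :
    Function.uncurry u =ᵐ[volume.restrict (Set.Iio (0 : ℝ) ×ˢ (Set.univ : Set (EuclideanSpace ℝ (Fin 3))))] 0 := by
  obtain ⟨hsw, hH, hgauge⟩ := hcls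
  obtain ⟨hu, hp⟩ := hss
  obtain ⟨hVG, -, hV6, -⟩ := hPG
  -- ### class data (as in `WeakEulerian.supportDensityLaw`)
  have hA : ∀ a : ℝ, 0 < a → ENNReal.ofReal (a ^ (2 * ρ)) *
      cknA a (0 : ℝ × EuclideanSpace ℝ (Fin 3)) u ≤ (c : ℝ≥0∞) :=
    fun a ha => le_trans (le_trans le_self_add le_self_add) (hgauge a ha)
  have hE : ∀ a : ℝ, 0 < a → ENNReal.ofReal (a ^ ρ) *
      cknE a (0 : ℝ × EuclideanSpace ℝ (Fin 3)) H ≤ (c : ℝ≥0∞) :=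
    fun a ha => le_trans (le_trans le_add_self le_self_add) (hgauge a ha)
  have hD : ∀ a : ℝ, 0 < a → ENNReal.ofReal (a ^ (2 * ρ)) *
      cknD a (0 : ℝ × EuclideanSpace ℝ (Fin 3)) p ≤ (c : ℝ≥0∞) :=
    fun a ha => le_trans le_add_self (hgauge a ha)
  have hu' : ∀ τ : ℝ, τ < 0 → u τ = fun x => selfSimilarCollapse (1 / (2 + ρ)) 0 V τ (x - 0) :=
    fun τ hτ => by rw [hu τ hτ]; funext x; rw [sub_zero]
  have hp' : ∀ τ : ℝ, τ < 0 → p τ = fun x => selfSimilarCollapsePressure (1 / (2 + ρ)) 0 P τ (x - 0) :=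
    fun τ hτ => by rw [hp τ hτ]; funext x; rw [sub_zero]
  obtain ⟨G', -, -, -, -, -, ⟨CA, hCA, hAgr⟩, -, -, -, -, -, hdivV, -, -, -⟩ :=
    Past.profileData_of_past hρ hρh le_rfl le_rfl 0 hsw.distributional hH hA hE hD hu' hp'
  have hVl : LocallyIntegrable V volume := locallyIntegrableOn_univ.1 (by
    simpa only [Opens.coe_top] using hVG.locallyIntegrableOn)
  have hγ : (0 : ℝ) < 1 / (2 + ρ) := by positivity
  have hγh : 1 / (2 + ρ) ≤ 1 / 2 := one_div_le_one_div_of_le two_pos (by linarith)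
  have h12 : 0 < 1 - 2 * (1 / (2 + ρ)) := by
    have h2 : (0 : ℝ) < 2 + ρ := by linarith
    have : 2 * (1 / (2 + ρ)) = 2 / (2 + ρ) := by ring
    rw [this, sub_pos, div_lt_one h2]; linarith
  -- `V ∈ L²_loc`
  have hV2 : ∀ r : ℝ, MemLp V 2 (volume.restrict (ball (0 : EuclideanSpace ℝ (Fin 3)) r)) := fun r => by
    haveI : IsFiniteMeasure ((volume : Measure (EuclideanSpace ℝ (Fin 3))).restrict (ball (0 : EuclideanSpace ℝ (Fin 3)) r)) :=
      isFiniteMeasure_restrict.2 measure_ball_lt_top.ne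
    exact (hV6 r).mono_exponent (by norm_num)
  -- the `A`-gauge growth in real form
  have hAreal : ∀ L : ℝ, 2 ≤ L → ∫ y in ball (0 : EuclideanSpace ℝ (Fin 3)) L, ‖V y‖ ^ 2 ≤ CA.toReal * L ^ (1 - 2 * ρ) := by
    intro L hL
    have hint : IntegrableOn (fun y => ‖V y‖ ^ 2) (ball (0 : EuclideanSpace ℝ (Fin 3)) L) volume := (hV2 L).integrable_norm_pow two_ne_zero
    have e : ∫ y in ball (0 : EuclideanSpace ℝ (Fin 3)) L, ‖V y‖ ^ 2 =
        (∫⁻ y in ball (0 : EuclideanSpace ℝ (Fin 3)) L, ‖V y‖ₑ ^ 2).toReal := by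
      rw [integral_eq_lintegral_of_nonneg_ae (Eventually.of_forall fun y => by positivity) hint.aestronglyMeasurable]
      congr 1
      refine lintegral_congr fun y => ?_
      rw [← ofReal_norm, ENNReal.ofReal_pow (norm_nonneg _)]
    rw [e, ← ENNReal.toReal_ofReal (by positivity : 0 ≤ L ^ (1 - 2 * ρ)), ← ENNReal.toReal_mul]
    exact ENNReal.toReal_mono (ENNReal.mul_ne_top hCA ENNReal.ofReal_ne_top) (hAgr L (by linarith))
  -- ### the Casimir data
  have hηm : AEStronglyMeasurable η volume := aestronglyMeasurable_of_memLp_ball hη2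
  obtain ⟨Cη, m, hm1, hgrη⟩ := hgr
  have hCη : 0 ≤ Cη := by
    have h := hgrη 1 le_rfl
    rw [Real.one_rpow, mul_one] at h
    exact (setIntegral_nonneg measurableSet_ball fun y _ => sq_nonneg (η y)).trans h
  obtain ⟨M, hM0, hM⟩ := exists_bound_deriv_smoothTransition
  have hβ0 : ∀ s : ℝ, 0 ≤ (1 + s ^ 2) ^ ((1 : ℝ) / 2) - 1 := fun s => betaq_nonneg zero_le_one s
  have hβle : ∀ s : ℝ, (1 + s ^ 2) ^ ((1 : ℝ) / 2) - 1 ≤ |s| := fun s =>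
    (betaq_le_abs_rpow zero_le_one (by norm_num) s).trans_eq (Real.rpow_one _)
  have hβc : Continuous fun s : ℝ => (1 + s ^ 2) ^ ((1 : ℝ) / 2) - 1 := (contDiff_betaq 1).continuous
  -- ### THE RACE: `(1 − 2γ) ∫_{B_{R₀}} β(η) ≤ K · R^{−ρ}` for `R ≥ max R₀ 1`
  set K : ℝ := 4 * M * √(2 * Cη * (CA.toReal * (2 : ℝ) ^ (1 - 2 * ρ))) with hK
  have hrace : ∀ R₀ R : ℝ, 1 ≤ R → R₀ ≤ R →
      (1 - 2 * (1 / (2 + ρ))) * ∫ y in ball (0 : EuclideanSpace ℝ (Fin 3)) R₀, ((1 + η y ^ 2) ^ ((1 : ℝ) / 2) - 1) ≤ K * R ^ (-ρ) := by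
    intro R₀ R hR1 hR₀
    have hR : 0 < R := by linarith
    -- monotonicity of the mass in the radius
    have hmono : ∫ y in ball (0 : EuclideanSpace ℝ (Fin 3)) R₀, ((1 + η y ^ 2) ^ ((1 : ℝ) / 2) - 1) ≤
        ∫ y in ball (0 : EuclideanSpace ℝ (Fin 3)) R, ((1 + η y ^ 2) ^ ((1 : ℝ) / 2) - 1) := by
      haveI : IsFiniteMeasure ((volume : Measure (EuclideanSpace ℝ (Fin 3))).restrict (ball (0 : EuclideanSpace ℝ (Fin 3)) R)) :=
        isFiniteMeasure_restrict.2 measure_ball_lt_top.ne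
      refine setIntegral_mono_set ?_ (Eventually.of_forall fun y => hβ0 _) (Eventually.of_forall (ball_subset_ball hR₀))
      refine Integrable.mono' ((hη2 R).integrable one_le_two).norm (hβc.comp_aestronglyMeasurable hηm).restrict
        (Eventually.of_forall fun y => ?_)
      rw [Real.norm_eq_abs, abs_of_nonneg (hβ0 _), Real.norm_eq_abs]
      exact hβle _
    -- the race inequality and the growth bounds
    have hml := casimir_mass_le hγ.le hγh hVl hV2 hηm hη2 hren hM0 hM hR
    have ha : ∫ y in ball (0 : EuclideanSpace ℝ (Fin 3)) (2 * R), η y ^ 2 ≤ 2 * Cη * R := by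
      refine (hgrη (2 * R) (by linarith)).trans ?_
      have h1 : (2 * R) ^ m ≤ (2 * R) ^ (1 : ℝ) := Real.rpow_le_rpow_of_exponent_le (by linarith) hm1.le
      rw [Real.rpow_one] at h1
      nlinarith [mul_le_mul_of_nonneg_left h1 hCη]
    have hb : ∫ y in ball (0 : EuclideanSpace ℝ (Fin 3)) (2 * R), ‖V y‖ ^ 2 ≤ CA.toReal * (2 : ℝ) ^ (1 - 2 * ρ) * R ^ (1 - 2 * ρ) := by
      refine (hAreal (2 * R) (by linarith)).trans_eq ?_
      rw [Real.mul_rpow (by norm_num) hR.le, mul_assoc]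
    -- `√a √b ≤ √(2Cη·CA·2^{1−2ρ}) · R^{1−ρ}`
    have hsq : √(∫ y in ball (0 : EuclideanSpace ℝ (Fin 3)) (2 * R), η y ^ 2) * √(∫ y in ball (0 : EuclideanSpace ℝ (Fin 3)) (2 * R), ‖V y‖ ^ 2) ≤
        √(2 * Cη * (CA.toReal * (2 : ℝ) ^ (1 - 2 * ρ))) * R ^ (1 - ρ) := by
      have hRe : R * R ^ (1 - 2 * ρ) = (R ^ (1 - ρ)) ^ 2 := by
        rw [← Real.rpow_natCast (R ^ (1 - ρ)) 2, ← Real.rpow_mul hR.le]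
        rw [show (1 - ρ) * ((2 : ℕ) : ℝ) = 1 + (1 - 2 * ρ) by push_cast; ring, Real.rpow_add hR, Real.rpow_one]
      calc √(∫ y in ball (0 : EuclideanSpace ℝ (Fin 3)) (2 * R), η y ^ 2) * √(∫ y in ball (0 : EuclideanSpace ℝ (Fin 3)) (2 * R), ‖V y‖ ^ 2)
          ≤ √(2 * Cη * R) * √(CA.toReal * (2 : ℝ) ^ (1 - 2 * ρ) * R ^ (1 - 2 * ρ)) :=
            mul_le_mul (Real.sqrt_le_sqrt ha) (Real.sqrt_le_sqrt hb) (Real.sqrt_nonneg _) (Real.sqrt_nonneg _)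
        _ = √(2 * Cη * (CA.toReal * (2 : ℝ) ^ (1 - 2 * ρ)) * (R * R ^ (1 - 2 * ρ))) := by
            rw [← Real.sqrt_mul (by positivity)]; ring_nf
        _ = √(2 * Cη * (CA.toReal * (2 : ℝ) ^ (1 - 2 * ρ))) * R ^ (1 - ρ) := by
            rw [Real.sqrt_mul (by positivity), hRe, Real.sqrt_sq (by positivity)]
    -- `(4M/R) · √c · R^{1−ρ} = K · R^{−ρ}`
    have hKR : 4 * M / R * (√(2 * Cη * (CA.toReal * (2 : ℝ) ^ (1 - 2 * ρ))) * R ^ (1 - ρ)) = K * R ^ (-ρ) := by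
      have e : R ^ (1 - ρ) = R * R ^ (-ρ) := by
        rw [sub_eq_add_neg, Real.rpow_add hR, Real.rpow_one]
      rw [hK, e]
      field_simp
    calc (1 - 2 * (1 / (2 + ρ))) * ∫ y in ball (0 : EuclideanSpace ℝ (Fin 3)) R₀, ((1 + η y ^ 2) ^ ((1 : ℝ) / 2) - 1)
        ≤ (1 - 2 * (1 / (2 + ρ))) * ∫ y in ball (0 : EuclideanSpace ℝ (Fin 3)) R, ((1 + η y ^ 2) ^ ((1 : ℝ) / 2) - 1) :=
          mul_le_mul_of_nonneg_left hmono h12.le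
      _ ≤ 4 * M / R * (√(∫ y in ball (0 : EuclideanSpace ℝ (Fin 3)) (2 * R), η y ^ 2) *
            √(∫ y in ball (0 : EuclideanSpace ℝ (Fin 3)) (2 * R), ‖V y‖ ^ 2)) := hml
      _ ≤ 4 * M / R * (√(2 * Cη * (CA.toReal * (2 : ℝ) ^ (1 - 2 * ρ))) * R ^ (1 - ρ)) :=
          mul_le_mul_of_nonneg_left hsq (by positivity)
      _ = K * R ^ (-ρ) := hKR
  -- ### the mass vanishes on every ball
  have hI0 : ∀ R₀ : ℝ, ∫ y in ball (0 : EuclideanSpace ℝ (Fin 3)) R₀, ((1 + η y ^ 2) ^ ((1 : ℝ) / 2) - 1) = 0 := by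
    intro R₀
    have hnn : 0 ≤ ∫ y in ball (0 : EuclideanSpace ℝ (Fin 3)) R₀, ((1 + η y ^ 2) ^ ((1 : ℝ) / 2) - 1) :=
      setIntegral_nonneg measurableSet_ball fun y _ => hβ0 _
    have hlim : Tendsto (fun R : ℝ => K * R ^ (-ρ)) atTop (𝓝 0) := by
      simpa using (tendsto_rpow_neg_atTop hρ).const_mul K
    have hle : (1 - 2 * (1 / (2 + ρ))) * ∫ y in ball (0 : EuclideanSpace ℝ (Fin 3)) R₀, ((1 + η y ^ 2) ^ ((1 : ℝ) / 2) - 1) ≤ 0 :=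
      ge_of_tendsto hlim (by
        filter_upwards [eventually_ge_atTop (max R₀ 1)] with R hR
        exact hrace R₀ R ((le_max_right _ _).trans hR) ((le_max_left _ _).trans hR))
    nlinarith [mul_nonneg h12.le hnn]
  -- ### `η = 0` a.e.
  have hη0 : ∀ᵐ y ∂(volume : Measure (EuclideanSpace ℝ (Fin 3))), η y = 0 := by
    have hball : ∀ n : ℕ, ∀ᵐ y ∂(volume.restrict (ball (0 : EuclideanSpace ℝ (Fin 3)) (n : ℝ))), η y = 0 := by
      intro n
      haveI : IsFiniteMeasure ((volume : Measure (EuclideanSpace ℝ (Fin 3))).restrict (ball (0 : EuclideanSpace ℝ (Fin 3)) (n : ℝ))) :=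
        isFiniteMeasure_restrict.2 measure_ball_lt_top.ne
      have hint : Integrable (fun y => (1 + η y ^ 2) ^ ((1 : ℝ) / 2) - 1) (volume.restrict (ball (0 : EuclideanSpace ℝ (Fin 3)) (n : ℝ))) := by
        refine Integrable.mono' ((hη2 n).integrable one_le_two).norm (hβc.comp_aestronglyMeasurable hηm).restrict
          (Eventually.of_forall fun y => ?_)
        rw [Real.norm_eq_abs, abs_of_nonneg (hβ0 _), Real.norm_eq_abs]
        exact hβle _
      have h := (integral_eq_zero_iff_of_nonneg_ae (Eventually.of_forall fun y => hβ0 (η y)) hint).1 (hI0 n)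
      filter_upwards [h] with y hy
      exact (betaq_eq_zero_iff one_pos).1 hy
    have hU : (⋃ n : ℕ, ball (0 : EuclideanSpace ℝ (Fin 3)) (n : ℝ)) = univ := iUnion_ball_nat 0
    have h' : ∀ᵐ y ∂(volume.restrict (⋃ n : ℕ, ball (0 : EuclideanSpace ℝ (Fin 3)) (n : ℝ))), η y = 0 :=
      (ae_restrict_iUnion_iff _ _).2 hball
    rwa [hU, Measure.restrict_univ] at h'
  -- ### the vorticity vanishes a.e.
  have hcurl : ∀ᵐ y ∂(volume : Measure (EuclideanSpace ℝ (Fin 3))), curlCLM (G y) = 0 := by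
    filter_upwards [hazi, hη0] with y h1 h2
    rw [h1, h2, zero_smul]
  -- ### symmetric, trace-free weak gradient with `A`-growth ⇒ `V = 0` a.e. (as in `WeakEulerian.supportDensityLaw`)
  have hsym : ∀ᵐ x ∂(volume : Measure (EuclideanSpace ℝ (Fin 3))), ∀ v w : EuclideanSpace ℝ (Fin 3), ⟪G x v, w⟫ = ⟪G x w, v⟫ := by
    filter_upwards [hcurl] with x hx
    exact WeakConfinedVorticity.symm_of_curlCLM_eq_zero hx
  have htr : ∀ᵐ x ∂(volume : Measure (EuclideanSpace ℝ (Fin 3))), ∑ j, G x (EuclideanSpace.single j (1 : ℝ)) j = 0 := by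
    filter_upwards [hdivV.trace_weakGradient_ae_eq_zero hVG] with x hx
    rw [LinearMap.trace_eq_sum_inner _ (EuclideanSpace.basisFun (Fin 3) ℝ)] at hx
    simpa [EuclideanSpace.basisFun_apply, EuclideanSpace.inner_single_left] using hx
  have hgrowth : ∀ r : ℝ, 2 < r → 0 < r →
      ∫⁻ x in ball (0 : EuclideanSpace ℝ (Fin 3)) r, ‖V x‖ₑ ^ 2 ≤ ENNReal.ofReal (CA.toReal * r ^ (1 - 2 * ρ)) := by
    intro r hr _
    rw [ENNReal.ofReal_mul ENNReal.toReal_nonneg, ENNReal.ofReal_toReal hCA]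
    exact hAgr r (by linarith)
  have hV0 : V =ᵐ[volume] 0 :=
    ae_eq_zero_of_symm_traceFree_of_growth hVG hsym htr (K := CA.toReal) (m := 1 - 2 * ρ) (r₀ := 2) (by linarith) hgrowth
  -- ### the member is trivial
  exact Past.ae_eq_zero_of_profile_ae_eq_zero (γ := 1 / (2 + ρ)) hρ.le le_rfl hsw hH hgauge hu' hV0

end Member

end Summit.NavierStokesRegularity.NavierStokesRegularity.Theorems.PowerGaugeEulerLiouville.WeakAxisym

end
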